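import Summits.AtomisticToContinuum.BoseEinsteinCondensation.Theses.BECIroning
import Summits.AtomisticToContinuum.BoseEinsteinCondensation.Theorems.BECIroningShellModeCountingDyadic
import Literature.MathematicalPhysics.QuantumManyBody.DiluteBoseGasUpperBoundLocalization
import Literature.MathematicalPhysics.QuantumManyBody.BoseGasThermodynamicLimitRuelle

/-!
# Route BECIroning, support item `ShellModeCounting` (stmt-AtomisticToContinuum-11430)

Closes `…Theses.BECIroning.ShellModeCounting`: for each repulsive finite-range `v`, the ironed
shell bound (body of `IroningShellBound` for `v`: for near-minimisers `Ψ` of the periodic `N`-body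
energy on the torus of side `L = (N/ρ)^{1/3}` and every cube radius `R ≥ 1`,
`∑_{0 < ‖n‖_∞ ≤ R} |2πn/L|² n_Ψ(2πn/L) ≤ C R³ (ρa + R²/L²)`) implies the PeriodicBEC body for
`v`: `⟨Ψ, n₀Ψ⟩ ≥ N/2` for the near-minimisers, at all small densities, eventually in `N`.

Proof (the item's sketch; architecture of the cousin `BECGroundStateSOSIRModeCounting`, with the
lemmas of `BECIroningShellModeCountingDyadic.lean`):
* Parseval in the traced variable, `∑_n n_Ψ = N`, and for the gradient
  `∑_n |2πn/L|² n_Ψ = ∫|∇Ψ|² ≤ ⟨Ψ,HΨ⟩` (tree: `PeriodicBoseGasFracEnergy`, inside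
  `condensate_ge_half_of_cube`);
* UV: the Dyson–LSSY upper bound `E₀^per ≤ AρN`, `A = 4πa(1 + C₁c₁)` (tree:
  `LSSY2005_upperBound_periodic_holds`), so with slack `δ ≤ ρN` and a dyadic cut-off
  `2^J ≥ κ√ρL`, `π²κ² = A + 1`, the modes outside the cube `‖n‖_∞ ≤ 2^J` carry
  `≤ (E₀+δ)L²/(4π²4^J) ≤ N/4`;
* IR (`dyadic_sum_le`): on the dyadic shell `2^j < ‖n‖_∞ ≤ 2^{j+1}` one has `|n|² ≥ 4^j`, so
  the shell bound at radius `2^{j+1}` gives the shell at most `(C/π²)(ρaL²2^{j+1} + 8^{j+1})`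
  particles; summing the geometric series, `∑_{0<‖n‖_∞≤2^J} n_Ψ ≤ (2C/π²)(ρaL² 2^J + 8^J)`,
  and with `2^J ≤ 2κ√ρL + 2`, `ρL³ = N` this is `≤ (K-1)√ρ N + 4CaρL² + 64C ≤ N/4` for
  `√ρ < 1/(8K)`, `L ≥ 64Ca`, `N ≥ 1024C` (`ir_arith`);
* hence `n₀ ≥ N − N/4 − N/4 = N/2`.

## References

* [LSSY2005] Lieb, Seiringer, Solovej, Yngvason, *The Mathematics of the Bose Gas and its
  Condensation* (2005), Thm. 2.2 (2.14); §1.2 (1.17)–(1.19).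
* [KLS1988PRL] Kennedy, Lieb, Shastry, Phys. Rev. Lett. 61 (1988) 2582 (IR bound ⇒ LRO).
* [DysonLiebSimon1978] Dyson, Lieb, Simon, J. Stat. Phys. 18 (1978) 335 (mode counting in `d = 3`).
-/

noncomputable section

open MeasureTheory Filter
open scoped ENNReal NNReal BigOperators

namespace Summit.AtomisticToContinuum.BoseEinsteinCondensation.Theorems


/-! ## §4 The route item -/

open Literature.MathematicalPhysics.QuantumManyBody.BoseGas
open Summit.AtomisticToContinuum.BoseEinsteinCondensation.Theses.BECIroning
open ShellCounting

/-- **Shell mode counting on the torus** (route BECIroning, item `ShellModeCounting`,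
stmt-AtomisticToContinuum-11430): for every repulsive finite-range `v`, the ironed shell bound
`∑_{0<‖n‖_∞≤R} |2πn/L|² n_Ψ(2πn/L) ≤ C R³ (ρa + R²/L²)` (`R ≥ 1`) for the `δ_N`-near-minimisers
on the torus of side `L_N = (N/ρ)^{1/3}` implies, for all small `ρ`, condensation
`⟨Ψ, n₀Ψ⟩ ≥ N/2` of the `δ'_N`-near-minimisers (`δ'_N = min(δ_N, ρN)`), eventually in `N`.
Constants: `π²κ² = A + 1` with `A = 4πa(1 + C₁c₁)` from LSSY Thm. 2.2 (UV tail beyond the dyadic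
cube radius `2^J ∈ [κ√ρL, 2κ√ρL+2]` is `≤ N/4` by the kinetic Markov bound), the dyadic IR sum
`≤ (2C/π²)(ρaL²2^J + 8^J) ≤ (K-1)√ρN + 4CaρL² + 64C ≤ N/4` with `K = 2C(2κa + 32κ³) + 1`,
`√ρ < 1/(8K)`, `L ≥ 64Ca`, `N ≥ 1024C`, and `ρ` below the LSSY threshold
`(a+1)(4πρ/3)^{1/3} < c₁`.
[cite: LSSY2005, Thm. 2.2 (2.14) and §1.2 (1.17)–(1.19)] -/
theorem ShellModeCounting_proof : ShellModeCounting := by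
  intro v hv hX
  -- constants attached to `v`: range, scattering length, the LSSY upper bound
  obtain ⟨R₀, -, hvR⟩ := hv.exists_pos_range
  obtain ⟨C₁, c₁, hC₁, hc₁, hLSSY⟩ :=
    LSSY2005_upperBound_periodic_holds v R₀ hv.1 hvR hv.scatteringLength_ne_top
  set a : ℝ := (scatteringLength v).toReal with ha
  have ha0 : 0 ≤ a := ENNReal.toReal_nonneg
  set A : ℝ := 4 * Real.pi * a * (1 + C₁ * c₁) with hA
  have hA0 : 0 ≤ A := by positivity
  set κ : ℝ := Real.sqrt (A + 1) / Real.pi with hκ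
  have hκ0 : 0 < κ := by positivity
  have hκ2 : Real.pi ^ 2 * κ ^ 2 = A + 1 := by
    rw [hκ, div_pow, Real.sq_sqrt (by positivity)]
    field_simp
  -- the hypothesis: the ironed shell bound for `v`
  obtain ⟨C, hC, ρX, hρX, hXv⟩ := hX
  set K : ℝ := 2 * C * (2 * κ * a + 32 * κ ^ 3) + 1 with hK
  have hK1 : 1 ≤ K := by
    have : 0 ≤ 2 * C * (2 * κ * a + 32 * κ ^ 3) := by positivity
    linarith
  have hK0 : 0 < K := lt_of_lt_of_le one_pos hK1
  -- density thresholds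
  set ρa : ℝ := 3 * (c₁ / (a + 1)) ^ 3 / (4 * Real.pi) with hρa
  have hρa0 : 0 < ρa := by positivity
  set ρC : ℝ := (1 / (8 * K)) ^ 2 with hρC
  have hρC0 : 0 < ρC := by positivity
  refine ⟨min ρX (min ρa ρC), lt_min hρX (lt_min hρa0 hρC0), fun ρ hρ hρ₀ => ?_⟩
  have hρX' : ρ < ρX := lt_of_lt_of_le hρ₀ (min_le_left _ _)
  have hρa' : ρ < ρa := lt_of_lt_of_le hρ₀ ((min_le_right _ _).trans (min_le_left _ _))
  have hρC' : ρ < ρC := lt_of_lt_of_le hρ₀ ((min_le_right _ _).trans (min_le_right _ _))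
  -- consequences of the thresholds
  have hsmall : (a + 1) * (4 * Real.pi * ρ / 3) ^ ((1 : ℝ) / 3) < c₁ := by
    have h1 : 4 * Real.pi * ρ / 3 < (c₁ / (a + 1)) ^ 3 := by
      rw [hρa, lt_div_iff₀ (by positivity)] at hρa'
      rw [div_lt_iff₀ (by norm_num : (0 : ℝ) < 3)]
      linarith
    have h2 : (4 * Real.pi * ρ / 3) ^ ((1 : ℝ) / 3) < c₁ / (a + 1) := by
      calc (4 * Real.pi * ρ / 3) ^ ((1 : ℝ) / 3) < ((c₁ / (a + 1)) ^ 3) ^ ((1 : ℝ) / 3) :=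
            Real.rpow_lt_rpow (by positivity) h1 (by norm_num)
        _ = c₁ / (a + 1) := by
            rw [show ((1 : ℝ) / 3) = ((3 : ℕ) : ℝ)⁻¹ by norm_num,
              Real.pow_rpow_inv_natCast (by positivity) (by norm_num)]
    calc (a + 1) * (4 * Real.pi * ρ / 3) ^ ((1 : ℝ) / 3) < (a + 1) * (c₁ / (a + 1)) := by
          gcongr
      _ = c₁ := by field_simp
  have hsqrtρ : 8 * K * Real.sqrt ρ ≤ 1 := by
    have h1 : Real.sqrt ρ < 1 / (8 * K) := by
      calc Real.sqrt ρ < Real.sqrt ρC := Real.sqrt_lt_sqrt hρ.le hρC'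
        _ = 1 / (8 * K) := by rw [hρC, Real.sqrt_sq (by positivity)]
    rw [lt_div_iff₀ (by positivity)] at h1
    linarith
  -- the answer: `c = 1/2`, eventually in `N`
  refine ⟨1 / 2, by norm_num, ?_⟩
  filter_upwards [hXv ρ hρ hρX', eventually_ge_atTop 2,
    (tendsto_sideLength_atTop hρ).eventually_gt_atTop (2 * R₀),
    (tendsto_sideLength_atTop hρ).eventually_ge_atTop (64 * C * a),
    eventually_ge_atTop ⌈1024 * C⌉₊] with N ⟨δX, hδX, hXN⟩ hN2 hRL hLa hNC
  have hN : 0 < N := lt_of_lt_of_le two_pos hN2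
  have hNr : (0 : ℝ) < N := Nat.cast_pos.2 hN
  have hNC' : 1024 * C ≤ N := (Nat.le_ceil _).trans (by exact_mod_cast hNC)
  set L : ℝ := sideLength ρ N with hLdef
  have hL : 0 < L := Real.rpow_pos_of_pos (div_pos hNr hρ) _
  have hL0 : L ≠ 0 := hL.ne'
  have hL3 : ρ * L ^ 3 = N := by
    rw [hLdef, sideLength_pow_three hρ N]
    field_simp
  -- the energy bound `E₀^per ≤ A ρ N` (LSSY Thm. 2.2 with `ρ₁ ≤ ρ`, `a/b ≤ c₁`)
  have hE0 : periodicGroundStateEnergy v N L ≤ ENNReal.ofReal (A * ρ * N) := by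
    have hL1 := hLSSY N L hN2 hL hRL
    simp only [] at hL1
    set ρ₁ : ℝ := ((N : ℝ) - 1) / L ^ 3 with hρ₁
    have hN2r : (2 : ℝ) ≤ N := by exact_mod_cast hN2
    have hρ₁0 : 0 ≤ ρ₁ := div_nonneg (by linarith) (by positivity)
    have hρ₁ρ : ρ₁ ≤ ρ := by
      rw [hρ₁, div_le_iff₀ (by positivity), hL3]
      linarith
    have hx : a * (4 * Real.pi * ρ₁ / 3) ^ ((1 : ℝ) / 3) ≤ c₁ := by
      have h1 :
          (4 * Real.pi * ρ₁ / 3) ^ ((1 : ℝ) / 3) ≤ (4 * Real.pi * ρ / 3) ^ ((1 : ℝ) / 3) :=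
        Real.rpow_le_rpow (by positivity) (by gcongr) (by norm_num)
      calc a * (4 * Real.pi * ρ₁ / 3) ^ ((1 : ℝ) / 3)
          ≤ (a + 1) * (4 * Real.pi * ρ / 3) ^ ((1 : ℝ) / 3) :=
            mul_le_mul (by linarith) h1 (by positivity) (by positivity)
        _ ≤ c₁ := hsmall.le
    have hL2 := hL1 (by rw [div_rpow_neg_third (by positivity)]; exact hx)
    rw [div_rpow_neg_third (by positivity)] at hL2
    refine hL2.trans (ENNReal.ofReal_le_ofReal ?_)
    rw [hA]
    calc 4 * Real.pi * ρ₁ * a * (1 + C₁ * (a * (4 * Real.pi * ρ₁ / 3) ^ ((1 : ℝ) / 3))) * N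
        ≤ 4 * Real.pi * ρ * a * (1 + C₁ * c₁) * N := by gcongr
      _ = 4 * Real.pi * a * (1 + C₁ * c₁) * ρ * N := by ring
  -- the dyadic cut-off `2^J ∈ [κ√ρL, 2κ√ρL + 2]`
  obtain ⟨J, hJ1, hJ2⟩ :=
    exists_pow_two_near (y := κ * Real.sqrt ρ * L) (by positivity)
  -- the slack `δ_N = min(δ_X, ρN)`
  refine ⟨min δX (ENNReal.ofReal (ρ * N)),
    lt_min hδX (ENNReal.ofReal_pos.2 (by positivity)), ?_⟩
  intro Ψ hΨ
  have hΨX : periodicEnergy v Ψ ≤ periodicGroundStateEnergy v N L + δX :=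
    hΨ.trans (add_le_add le_rfl (min_le_left _ _))
  have hΨE : periodicEnergy v Ψ ≤ ENNReal.ofReal ((A + 1) * ρ * N) := by
    calc periodicEnergy v Ψ ≤ periodicGroundStateEnergy v N L + ENNReal.ofReal (ρ * N) :=
          hΨ.trans (add_le_add le_rfl (min_le_right _ _))
      _ ≤ ENNReal.ofReal (A * ρ * N) + ENNReal.ofReal (ρ * N) := add_le_add hE0 le_rfl
      _ = ENNReal.ofReal ((A + 1) * ρ * N) := by
          rw [← ENNReal.ofReal_add (by positivity) (by positivity)]
          exact congrArg ENNReal.ofReal (by ring)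
  -- the counting step with cube radius `2^J` and `D = 4π²4^J/L²`
  set D : ℝ≥0∞ := ENNReal.ofReal (4 * Real.pi ^ 2 * (2 ^ J) ^ 2 / L ^ 2) with hD
  have hDpos : 0 < 4 * Real.pi ^ 2 * (2 ^ J) ^ 2 / L ^ 2 := by positivity
  have hD0 : D ≠ 0 := (ENNReal.ofReal_pos.2 hDpos).ne'
  refine condensate_ge_half_of_cube hL v Ψ (2 ^ J) hD0 ENNReal.ofReal_ne_top ?_ ?_ ?_
  · -- (UV) `4π²4^J/L² ≤ |2πk/L|²` outside the cube of radius `2^J`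
    intro k hk
    rw [hD, fracDispersion_two]
    refine ENNReal.ofReal_le_ofReal ?_
    have h1 := sq_le_normSq_of_not_mem_cube hk
    push_cast at h1
    have h2 : ((2 : ℝ) ^ J) ^ 2 ≤ ∑ j, ((k j : ℤ) : ℝ) ^ 2 := by
      nlinarith [h1, pow_pos (two_pos : (0 : ℝ) < 2) J]
    gcongr
  · -- (T) `(E₀ + δ) L²/(4π²4^J) ≤ (A+1)ρN L²/(4π²κ²ρL²) = N/4`
    have hY2 : κ ^ 2 * ρ * L ^ 2 ≤ (2 ^ J) ^ 2 := by
      calc κ ^ 2 * ρ * L ^ 2 = (κ * Real.sqrt ρ * L) ^ 2 := by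
            rw [mul_pow, mul_pow, Real.sq_sqrt hρ.le]
        _ ≤ (2 ^ J) ^ 2 := by gcongr
    calc D⁻¹ * periodicEnergy v Ψ ≤ D⁻¹ * ENNReal.ofReal ((A + 1) * ρ * N) := by gcongr
      _ = ENNReal.ofReal ((A + 1) * ρ * N / (4 * Real.pi ^ 2 * (2 ^ J) ^ 2 / L ^ 2)) := by
          rw [← ENNReal.div_eq_inv_mul, hD, ← ENNReal.ofReal_div_of_pos hDpos]
      _ ≤ ENNReal.ofReal (N / 4) := by
          refine ENNReal.ofReal_le_ofReal ?_
          rw [div_le_iff₀ hDpos, ← hκ2]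
          calc Real.pi ^ 2 * κ ^ 2 * ρ * N = Real.pi ^ 2 * N / L ^ 2 * (κ ^ 2 * ρ * L ^ 2) := by
                field_simp
            _ ≤ Real.pi ^ 2 * N / L ^ 2 * (2 ^ J) ^ 2 := by gcongr
            _ = N / 4 * (4 * Real.pi ^ 2 * (2 ^ J) ^ 2 / L ^ 2) := by
                field_simp
  · -- (IR) the dyadic sum of the shell bounds
    have hB : ∀ j, j ≤ J →
        ∑ n ∈ (Finset.Icc (fun _ : Fin 3 => -((2 ^ j : ℕ) : ℤ))
            (fun _ : Fin 3 => ((2 ^ j : ℕ) : ℤ))).erase 0,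
          ENNReal.ofReal (4 * Real.pi ^ 2 * (∑ i : Fin 3, ((n i : ℤ) : ℝ) ^ 2) / L ^ 2) *
            (fun k => cellOccupation N L
              (fun x => ((Real.sqrt (L ^ 3))⁻¹ : ℂ) * cellWave L k x) Ψ.ψ) n ≤
          ENNReal.ofReal
            (C * ((2 ^ j : ℕ) : ℝ) ^ 3 * (ρ * a + ((2 ^ j : ℕ) : ℝ) ^ 2 / L ^ 2)) :=
      fun j _ => hXN Ψ hΨX (2 ^ j) Nat.one_le_two_pow
    refine (dyadic_sum_le hL hC.le (by positivity)
      (fun k => cellOccupation N L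
        (fun x => ((Real.sqrt (L ^ 3))⁻¹ : ℂ) * cellWave L k x) Ψ.ψ)
      J hB).trans (ENNReal.ofReal_le_ofReal ?_)
    -- `(2C/π²)(ρaL²2^J + 8^J) ≤ N/4`
    exact ir_arith hC.le hκ0.le ha0 hρ hL hNr.le hL3 (by positivity) hJ2 hK hsqrtρ hLa hNC'

end Summit.AtomisticToContinuum.BoseEinsteinCondensation.Theorems

end
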